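import Summits.MatrixMultiplication.MatrixMultiplication.Theorems.ThresholdSubsetTriples.Negative.RootedStabilisers
import Summits.MatrixMultiplication.MatrixMultiplication.Theorems.ThresholdSubsetTriples.Negative.YoungAndSliceRank

/-!
# `ThresholdSubsetTriples` (crux stmt-MatrixMultiplication-10882, route `SnSubsetDichotomy`) —
# negative-side support V: pairwise information is void (refuter cdisprove; gen-1 §5b, filed by gen 2)

Definition-free copy of §5b of the crux workfile `Cruxes/ThresholdSubsetTriples/Disproof.lean`.  Any
refutation of `X = ThresholdSubsetTriples` must use the genuinely THREE-fold triple product property: with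
the TPP weakened to its three two-set consequences (`PairwiseTPP[S, T, U]`, a local notation; implied by
the TPP for non-empty sets, `pairwiseTPP_of_tripleProductProperty`) the threshold statement is TRUE at every
scale `c > 0` (`thresholdSubsetTriplesPairwise_holds`), witnessed by the rooted matching stabilisers
`K_a = C(μ_a) ∩ Stab(0)` of the matchings `{x, a - x}` of `ℤ/n`, `a = 1, 3, 5`, `n ≡ 2 (mod 4)`
(`Negative.RootedStabilisers`: pairwise trivial, `rootedStab_inf_eq_bot`, and
`(n!)^{3/2} ≤ n³·|K_1||K_3||K_5|`, `factorial_rpow_le_rootedTriple`) — polynomial slack `n³`, which beats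
`e^{-c√n}` for every `c > 0`.  So packing / pairwise-counting / host-size arguments against `X` stop at
slack `n³`.  (The configuration is not a witness for `X`: `Negative.rootedTriple_not_tpp`.)

Sources: Cohn–Umans 2003 Def. 2.1; Blasiak–Church–Cohn–Grochow–Umans 2017 (arXiv:1712.02302) §4–5;
James–Kerber 1981 (centralisers of fixed-point-free involutions, `|C(μ)| = 2^m m!`); folklore.
-/

noncomputable section

set_option linter.dupNamespace false
set_option autoImplicit false

open scoped BigOperators

namespace Summit.MatrixMultiplication.MatrixMultiplication.Theorems.ThresholdSubsetTriples.Negative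

open Summit.MatrixMultiplication.MatrixMultiplication.Theses.SnSubsetDichotomy
open Literature.Combinatorics.Additive

/-- `Beats[c, n, S, T, U]`: the volume condition `(n!)^{3/2}·e^{-c√n} < |S||T||U|` (local notation). -/
local notation3 "Beats[" c ", " n ", " S ", " T ", " U "]" =>
  ((Nat.factorial n : ℕ) : ℝ) ^ ((3 : ℝ) / 2) * Real.exp (-(c * Real.sqrt ((n : ℕ) : ℝ))) <
    ((Finset.card S * Finset.card T * Finset.card U : ℕ) : ℝ)

/-- `PairwiseTPP[S, T, U]`: the three two-set consequences `q_X q_Y = 1 ⇒ q_X = q_Y = 1` of the TPP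
(local notation, no new definition). -/
local notation3 (prettyPrint := false) "PairwiseTPP[" S ", " T ", " U "]" =>
  (∀ s ∈ (S : Finset _), ∀ s' ∈ S, ∀ t ∈ (T : Finset _), ∀ t' ∈ T,
      s * s'⁻¹ * (t * t'⁻¹) = 1 → s = s' ∧ t = t') ∧
  (∀ t ∈ (T : Finset _), ∀ t' ∈ T, ∀ u ∈ (U : Finset _), ∀ u' ∈ U,
      t * t'⁻¹ * (u * u'⁻¹) = 1 → t = t' ∧ u = u') ∧
  (∀ s ∈ (S : Finset _), ∀ s' ∈ S, ∀ u ∈ (U : Finset _), ∀ u' ∈ U,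
      s * s'⁻¹ * (u * u'⁻¹) = 1 → s = s' ∧ u = u')

/-- The TPP implies the pairwise TPP as soon as the three sets are non-empty. -/
theorem pairwiseTPP_of_tripleProductProperty {G : Type*} [Group G] {S T U : Finset G}
    (h : TripleProductProperty S T U) (hS : S.Nonempty) (hT : T.Nonempty) (hU : U.Nonempty) :
    PairwiseTPP[S, T, U] := by
  obtain ⟨s₀, hs₀⟩ := hS
  obtain ⟨t₀, ht₀⟩ := hT
  obtain ⟨u₀, hu₀⟩ := hU
  refine ⟨fun s hs s' hs' t ht t' ht' he => ?_, fun t ht t' ht' u hu u' hu' he => ?_,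
    fun s hs s' hs' u hu u' hu' he => ?_⟩
  · have h1 := h s hs s' hs' t ht t' ht' u₀ hu₀ u₀ hu₀ (by rw [mul_inv_cancel, mul_one]; exact he)
    exact ⟨h1.1, h1.2.1⟩
  · have h1 := h s₀ hs₀ s₀ hs₀ t ht t' ht' u hu u' hu' (by rw [mul_inv_cancel, one_mul]; exact he)
    exact ⟨h1.2.1, h1.2.2⟩
  · have h1 := h s hs s' hs' t₀ ht₀ t₀ ht₀ u hu u' hu' (by rw [mul_inv_cancel, mul_one]; exact he)
    exact ⟨h1.1, h1.2.2⟩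

/-- Two subgroups with trivial meet, as `Finset`s, satisfy the two-set condition. -/
theorem pairCond_of_inf_eq_bot {G : Type*} [Group G] [Fintype G] (H K : Subgroup G)
    [DecidablePred (· ∈ H)] [DecidablePred (· ∈ K)] (h : H ⊓ K = ⊥) :
    ∀ s ∈ Finset.univ.filter (· ∈ H), ∀ s' ∈ Finset.univ.filter (· ∈ H),
      ∀ t ∈ Finset.univ.filter (· ∈ K), ∀ t' ∈ Finset.univ.filter (· ∈ K),
        s * s'⁻¹ * (t * t'⁻¹) = 1 → s = s' ∧ t = t' := by
  intro s hs s' hs' t ht t' ht' he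
  simp only [Finset.mem_filter, Finset.mem_univ, true_and] at hs hs' ht ht'
  have hq : s * s'⁻¹ = (t * t'⁻¹)⁻¹ := eq_inv_of_mul_eq_one_left he
  have hH : s * s'⁻¹ ∈ H := H.mul_mem hs (H.inv_mem hs')
  have hK : s * s'⁻¹ ∈ K := by rw [hq]; exact K.inv_mem (K.mul_mem ht (K.inv_mem ht'))
  have h1 : s * s'⁻¹ = 1 := by
    have hmem : s * s'⁻¹ ∈ H ⊓ K := Subgroup.mem_inf.2 ⟨hH, hK⟩
    rw [h] at hmem
    exact Subgroup.mem_bot.1 hmem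
  refine ⟨mul_inv_eq_one.1 h1, ?_⟩
  rw [h1] at hq
  have h2 : t * t'⁻¹ = 1 := inv_eq_one.1 hq.symm
  exact mul_inv_eq_one.1 h2

section Rooted

open Fin.CommRing

/-- `μ[n, a]`: the matching involution `x ↦ a - x` of `ℤ/n`; `K[n, a] = C(μ_a) ∩ Stab(0)` (local
notations, as in `Negative.RootedStabilisers`). -/
local notation3 (prettyPrint := false) "μ[" n ", " a "]" =>
  (Equiv.subLeft ((a : ℕ) : Fin n) : Equiv.Perm (Fin n))

local notation3 (prettyPrint := false) "K[" n ", " a "]" =>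
  (Subgroup.centralizer {μ[n, a]} ⊓ MulAction.stabilizer (Equiv.Perm (Fin n)) (0 : Fin n) :
    Subgroup (Equiv.Perm (Fin n)))

/-- **The pairwise weakening of `X` is TRUE** (rooted matching stabilisers `K_1, K_3, K_5` at
`n = 4k + 2`): `(n!)^{3/2} ≤ n³|K_1||K_3||K_5|` and `n³ < e^{c√n}` eventually.  Hence a proof of `¬X`
cannot be a pairwise/packing argument: it must use the three-fold condition. -/
theorem thresholdSubsetTriplesPairwise_holds :
    ∀ c : ℝ, 0 < c → ∀ n₀ : ℕ, ∃ n ≥ n₀, ∃ S T U : Finset (Equiv.Perm (Fin n)),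
      PairwiseTPP[S, T, U] ∧ Beats[c, n, S, T, U] := by
  intro c hc n₀
  classical
  obtain ⟨n₁, -, hev⟩ := eventually_dlog_le_sqrt c 3 hc
  obtain ⟨n, hn, hn4, hn₁⟩ : ∃ n : ℕ, n₀ ≤ n ∧ n % 4 = 2 ∧ n₁ ≤ n :=
    ⟨4 * max n₀ n₁ + 2, by omega, by omega, by omega⟩
  haveI : NeZero n := ⟨by omega⟩
  refine ⟨n, hn, Finset.univ.filter (· ∈ K[n, 1]), Finset.univ.filter (· ∈ K[n, 3]),
    Finset.univ.filter (· ∈ K[n, 5]), ?_, ?_⟩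
  · exact ⟨pairCond_of_inf_eq_bot _ _ (rootedStab_inf_eq_bot hn4 ⟨0, rfl⟩ (Or.inl rfl)),
      pairCond_of_inf_eq_bot _ _ (rootedStab_inf_eq_bot hn4 ⟨1, rfl⟩ (Or.inl rfl)),
      pairCond_of_inf_eq_bot _ _ (rootedStab_inf_eq_bot hn4 ⟨0, rfl⟩ (Or.inr rfl))⟩
  · rw [card_filter_mem_subgroup (K[n, 1]), card_filter_mem_subgroup (K[n, 3]),
      card_filter_mem_subgroup (K[n, 5])]
    have hvol := factorial_rpow_le_rootedTriple hn4
    simp only [Matrix.cons_val_zero, Matrix.cons_val_one, Matrix.head_cons,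
      Matrix.cons_val_two, Matrix.tail_cons] at hvol
    set V : ℝ := ((Nat.card (K[n, 1]) * Nat.card (K[n, 3]) * Nat.card (K[n, 5]) : ℕ) : ℝ) with hV
    have hV0 : 0 < V := by
      rw [hV]
      have h1 : 0 < Nat.card (K[n, 1]) := Nat.card_pos
      have h3 : 0 < Nat.card (K[n, 3]) := Nat.card_pos
      have h5 : 0 < Nat.card (K[n, 5]) := Nat.card_pos
      positivity
    have hn0 : (0 : ℝ) < n := by
      have : 0 < n := by omega
      exact_mod_cast this
    have hlog : 3 * Real.log n < c * Real.sqrt n := by linarith [hev n hn₁]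
    have hn3 : (n : ℝ) ^ (3 : ℝ) < Real.exp (c * Real.sqrt n) := by
      rw [Real.rpow_def_of_pos hn0]
      exact Real.exp_lt_exp.2 (by linarith)
    have hexp0 : 0 < Real.exp (-(c * Real.sqrt n)) := Real.exp_pos _
    have hsmall : (n : ℝ) ^ (3 : ℝ) * Real.exp (-(c * Real.sqrt n)) < 1 := by
      calc (n : ℝ) ^ (3 : ℝ) * Real.exp (-(c * Real.sqrt n))
          < Real.exp (c * Real.sqrt n) * Real.exp (-(c * Real.sqrt n)) :=
            mul_lt_mul_of_pos_right hn3 hexp0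
        _ = 1 := by rw [← Real.exp_add, add_neg_cancel, Real.exp_zero]
    calc (n.factorial : ℝ) ^ ((3 : ℝ) / 2) * Real.exp (-(c * Real.sqrt n))
        ≤ (n : ℝ) ^ (3 : ℝ) * V * Real.exp (-(c * Real.sqrt n)) :=
          mul_le_mul_of_nonneg_right hvol hexp0.le
      _ = V * ((n : ℝ) ^ (3 : ℝ) * Real.exp (-(c * Real.sqrt n))) := by ring
      _ < V * 1 := mul_lt_mul_of_pos_left hsmall hV0
      _ = V := mul_one _

end Rooted

/-- For the record: the TPP at the threshold implies the pairwise TPP (threshold triples are non-empty),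
so `X →` its pairwise weakening; the converse is exactly what fails to be provable. -/
theorem thresholdSubsetTriplesPairwise_of_thresholdSubsetTriples (h : ThresholdSubsetTriples) :
    ∀ c : ℝ, 0 < c → ∀ n₀ : ℕ, ∃ n ≥ n₀, ∃ S T U : Finset (Equiv.Perm (Fin n)),
      PairwiseTPP[S, T, U] ∧ Beats[c, n, S, T, U] := by
  intro c hc n₀
  obtain ⟨n, hn, S, T, U, hTPP, hlt⟩ := h c hc n₀
  have hprod : 0 < S.card * T.card * U.card := by
    have h0 : (0 : ℝ) < ((S.card * T.card * U.card : ℕ) : ℝ) := lt_of_le_of_lt (by positivity) hlt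
    exact_mod_cast h0
  have hS : S.Nonempty := Finset.card_pos.1 (Nat.pos_of_ne_zero fun h0 => by simp [h0] at hprod)
  have hT : T.Nonempty := Finset.card_pos.1 (Nat.pos_of_ne_zero fun h0 => by simp [h0] at hprod)
  have hU : U.Nonempty := Finset.card_pos.1 (Nat.pos_of_ne_zero fun h0 => by simp [h0] at hprod)
  exact ⟨n, hn, S, T, U, pairwiseTPP_of_tripleProductProperty hTPP hS hT hU, hlt⟩

end Summit.MatrixMultiplication.MatrixMultiplication.Theorems.ThresholdSubsetTriples.Negative

end
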